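import Summits.CriticalPhenomena.PercolationContinuityZ3.Theorems.PercNearOneGluingNoHeavyLowerTailCILUnionExchange
import HarnessLib

/-!
# `NoHeavyLowerTail` (stmt-CriticalPhenomena-4575) — the ENDPOINT of the pair union exchange ("explaining away")

Prover `prim-gen-induct` (gen 7), `--supports stmt-CriticalPhenomena-4575`.  No definitions, no named facts, no sorries.

Continuation of `…CILUnionExchange.lean`.  There (Kozma–Nitzan's Theorem 1 for an arbitrary increasing cluster
functional) the law of `C_o` given `U = {o ↔ a₁} ∪ {o ↔ a₂}` dominates the `(φ₁ : φ₂)`-mixture of the laws of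
`C_{a₁}`, `C_{a₂}`, `φᵢ = μ(a₁ ↮ a₂, o ↔ aᵢ)`.  Numerically (BLOBQUOTIENT.md §26 of the prover's notes) the admissible
mixture weights form a whole segment, whose endpoints put the weight `τᵢ = μ(o ↔ aᵢ | a₁ ↮ a₂)` — the attachment
probability in the DISCONNECTED world — on one terminal and the rest on the other.  This file proves the endpoint:

* `UnionExchange.pair_clusterDominance_endpoint`: with `D = {a₁ ↮ a₂}`,
  `(μ(D) μ(U) − μ(D ∩ {o ↔ a₂})) · μ{C_{a₁} ∈ 𝒜} + μ(D ∩ {o ↔ a₂}) · μ{C_{a₂} ∈ 𝒜} ≤ μ(D) · μ(U ∩ {C_o ∈ 𝒜})`.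

The proof is three inequalities: Harris for `{C_{a₁} ∈ 𝒜}` and `U`; BHK 2006 Thm 1.3 in `C_{a₂}` given `D`; and BHK
Thm 1.4 (the clusters of `a₁`, `a₂` are negatively correlated given `D`) — the last one is what controls the
"explaining-away" deficit `μ(U | C ∈ 𝒜, a₁ ↔ a₂) < μ(U | a₁ ↔ a₂)` that makes the naive statement false.
The version with an avoided vertex (`x ↮ a` throughout), which is what the anchor-gate line of the crux needs
(RHLA for `|B| = 3`), is recorded in the notes as conjecture (COV) with its harness census.
-/

noncomputable section

open MeasureTheory Set
open Literature.Probability.LatticeModels (prodBernoulli)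
open Literature.Probability.Percolation Literature.Probability.Percolation.KNPreFKG

namespace Summit.CriticalPhenomena.PercolationContinuityZ3.Theorems

namespace UnionExchange

variable {V : Type*} [Fintype V]

/-- **The endpoint of the union exchange ("explaining-away" form).**  For `a₁ ≠ a₂`, `U = {o ↔ a₁} ∪ {o ↔ a₂}`,
`D = {a₁ ↮ a₂}` and any upper family `𝒜` of edge sets:
`μ(D) · μ(U ∩ {C_o ∈ 𝒜}) ≥ (μ(D) μ(U) − μ(D ∩ {o ↔ a₂})) · μ{C_{a₁} ∈ 𝒜} + μ(D ∩ {o ↔ a₂}) · μ{C_{a₂} ∈ 𝒜}`,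
i.e. the law of `C_o` given `o ↔ {a₁, a₂}` dominates the mixture of the laws of `C_{a₁}`, `C_{a₂}` which puts the
SMALLEST admissible weight `τ₂ = μ(o ↔ a₂ | a₁ ↮ a₂)` on `C_{a₂}` (Kozma–Nitzan's weights `τ₁ : τ₂` are a convex
combination of this endpoint and its mirror image).  Proof: split `U ∩ {C_o ∈ 𝒜}` along `{o ↔ a₁}`; BHK Thm 1.3 in
`C_{a₂}` given `D`; Harris for `{C_{a₁} ∈ 𝒜}` and `U`; BHK Thm 1.4 for `C_{a₁}, C_{a₂}` given `D`. -/
theorem pair_clusterDominance_endpoint (w : Sym2 V → unitInterval) (o a₁ a₂ : V) (h12 : a₁ ≠ a₂)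
    {𝒜 : Set (Set (Sym2 V))} (h𝒜 : IsUpperSet 𝒜) :
    ((prodBernoulli w).real {ω : BondConfig V | ¬ (openGraph ω).Reachable a₁ a₂} *
          (prodBernoulli w).real (openConn o a₁ ∪ openConn o a₂ : Set (BondConfig V)) -
        (prodBernoulli w).real ({ω : BondConfig V | ¬ (openGraph ω).Reachable a₁ a₂} ∩ openConn o a₂)) *
        (prodBernoulli w).real {ω : BondConfig V | openEdgeCluster ω a₁ ∈ 𝒜} +
      (prodBernoulli w).real ({ω : BondConfig V | ¬ (openGraph ω).Reachable a₁ a₂} ∩ openConn o a₂) *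
        (prodBernoulli w).real {ω : BondConfig V | openEdgeCluster ω a₂ ∈ 𝒜} ≤
    (prodBernoulli w).real {ω : BondConfig V | ¬ (openGraph ω).Reachable a₁ a₂} *
      (prodBernoulli w).real ((openConn o a₁ ∪ openConn o a₂) ∩ {ω | openEdgeCluster ω o ∈ 𝒜}) := by
  classical
  set μ := prodBernoulli w with hμ
  set O₁ : Set (BondConfig V) := openConn o a₁ with hO₁
  set O₂ : Set (BondConfig V) := openConn o a₂ with hO₂
  set A₀ : Set (BondConfig V) := {ω | openEdgeCluster ω o ∈ 𝒜} with hA₀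
  set A₁ : Set (BondConfig V) := {ω | openEdgeCluster ω a₁ ∈ 𝒜} with hA₁
  set A₂ : Set (BondConfig V) := {ω | openEdgeCluster ω a₂ ∈ 𝒜} with hA₂
  set D : Set (BondConfig V) := {ω | ¬ (openGraph ω).Reachable a₁ a₂} with hD
  set E : Set (BondConfig V) := (O₁ ∪ O₂) ∩ A₀ with hE
  have hsplit : ∀ A S : Set (BondConfig V), μ.real A = μ.real (A ∩ S) + μ.real (A ∩ Sᶜ) := by
    intro A S
    rw [← measureReal_inter_add_sdiff (s := A) (MeasurableSet.of_discrete : MeasurableSet S), Set.sdiff_eq]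
  -- identities
  have hE1 : E ∩ O₁ = A₁ ∩ O₁ := by
    ext ω
    simp only [mem_inter_iff, mem_union, hE, hA₀, hA₁, mem_setOf_eq]
    constructor
    · rintro ⟨⟨_, hA⟩, h1⟩
      exact ⟨by rw [openEdgeCluster_eq_of_reachable (show ω ∈ openConn o a₁ from h1)]; exact hA, h1⟩
    · rintro ⟨hA, h1⟩
      exact ⟨⟨Or.inl h1, by rw [← openEdgeCluster_eq_of_reachable (show ω ∈ openConn o a₁ from h1)]; exact hA⟩, h1⟩
  have hE1c : E ∩ O₁ᶜ = O₂ ∩ A₂ ∩ D := by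
    ext ω
    simp only [mem_inter_iff, mem_union, mem_compl_iff, hE, hO₁, hO₂, hA₀, hA₂, hD, openConn,
      mem_setOf_eq]
    constructor
    · rintro ⟨⟨h1 | h2, hA⟩, hn1⟩
      · exact absurd h1 hn1
      · refine ⟨⟨h2, ?_⟩, fun h => hn1 (h2.trans h.symm)⟩
        rw [openEdgeCluster_eq_of_reachable h2]; exact hA
    · rintro ⟨⟨h2, hA⟩, hn⟩
      refine ⟨⟨Or.inr h2, ?_⟩, fun h1 => hn (h1.symm.trans h2)⟩
      rw [← openEdgeCluster_eq_of_reachable h2]; exact hA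
  have hU1 : (A₁ ∩ (O₁ ∪ O₂)) ∩ O₁ = A₁ ∩ O₁ := by
    ext ω
    simp only [mem_inter_iff, mem_union]
    tauto
  have hU1c : (A₁ ∩ (O₁ ∪ O₂)) ∩ O₁ᶜ = O₂ ∩ A₁ ∩ D := by
    ext ω
    simp only [mem_inter_iff, mem_union, mem_compl_iff, hO₁, hO₂, hD, openConn, mem_setOf_eq]
    constructor
    · rintro ⟨⟨hA, h1 | h2⟩, hn1⟩
      · exact absurd h1 hn1
      · exact ⟨⟨h2, hA⟩, fun h => hn1 (h2.trans h.symm)⟩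
    · rintro ⟨⟨h2, hA⟩, hn⟩
      exact ⟨⟨hA, Or.inr h2⟩, fun h1 => hn (h1.symm.trans h2)⟩
  have hA2D : A₂ ∩ Dᶜ = A₁ ∩ Dᶜ := by
    ext ω
    simp only [mem_inter_iff, mem_compl_iff, hA₁, hA₂, hD, mem_setOf_eq, not_not]
    constructor
    · rintro ⟨hA, h⟩
      exact ⟨by rw [← openEdgeCluster_eq_of_reachable h]; exact hA, h⟩
    · rintro ⟨hA, h⟩
      exact ⟨by rw [openEdgeCluster_eq_of_reachable h]; exact hA, h⟩
  have hmE : μ.real E = μ.real (A₁ ∩ O₁) + μ.real (O₂ ∩ A₂ ∩ D) := by rw [hsplit E O₁, hE1, hE1c]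
  have hmAU : μ.real (A₁ ∩ (O₁ ∪ O₂)) = μ.real (A₁ ∩ O₁) + μ.real (O₂ ∩ A₁ ∩ D) := by
    rw [hsplit (A₁ ∩ (O₁ ∪ O₂)) O₁, hU1, hU1c]
  have hmA1 : μ.real A₁ = μ.real (A₁ ∩ D) + μ.real (A₁ ∩ Dᶜ) := hsplit A₁ D
  have hmA2 : μ.real A₂ = μ.real (A₂ ∩ D) + μ.real (A₁ ∩ Dᶜ) := by rw [hsplit A₂ D, hA2D]
  -- BHK given `D = {a₁ ↮ a₂}`
  have hD2 : {ω : BondConfig V | ∀ x ∈ ({a₁} : Set V), ¬ (openGraph ω).Reachable a₂ x} = D := by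
    ext ω
    simp only [mem_setOf_eq, mem_singleton_iff, forall_eq, hD]
    exact not_congr ⟨SimpleGraph.Reachable.symm, SimpleGraph.Reachable.symm⟩
  have hD3 : {ω : BondConfig V | ¬ (openGraph ω).Reachable a₂ a₁} = D := by
    ext ω
    simp only [mem_setOf_eq, hD]
    exact not_congr ⟨SimpleGraph.Reachable.symm, SimpleGraph.Reachable.symm⟩
  -- (i) Thm 1.3 in `C_{a₂}`: `μ(D, o↔a₂) μ(D, C_{a₂}∈𝒜) ≤ μ(D) μ(D, o↔a₂, C_{a₂}∈𝒜)`
  have h_i := bhk_one_upper_upper w a₂ ({a₁} : Set V) (by simpa using Ne.symm h12)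
    (isUpperSet_connFamily a₂ o) h𝒜
  rw [hD2, ← openConn_eq_setOf_connFamily, openConn_symm a₂ o] at h_i
  -- (ii) Thm 1.4: `μ(D) μ(D, o↔a₂, C_{a₁}∈𝒜) ≤ μ(D, o↔a₂) μ(D, C_{a₁}∈𝒜)`
  have h_ii := bhk_two_upper_upper w a₂ a₁ (Ne.symm h12) (isUpperSet_connFamily a₂ o) h𝒜
  rw [hD3, ← openConn_eq_setOf_connFamily, openConn_symm a₂ o] at h_ii
  simp only [← hμ, ← hO₂, ← hA₁, ← hA₂] at h_i h_ii
  have e1 : D ∩ (O₂ ∩ A₂) = O₂ ∩ A₂ ∩ D := inter_comm _ _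
  have e2 : D ∩ (O₂ ∩ A₁) = O₂ ∩ A₁ ∩ D := inter_comm _ _
  have e3 : D ∩ A₁ = A₁ ∩ D := inter_comm _ _
  have e4 : D ∩ A₂ = A₂ ∩ D := inter_comm _ _
  rw [e1, e4] at h_i
  rw [e2, e3] at h_ii
  -- (iii) Harris for `{C_{a₁} ∈ 𝒜}` and `U`
  have hU : IsUpperSet (O₁ ∪ O₂ : Set (BondConfig V)) :=
    (isUpperSet_openConn o a₁).union (isUpperSet_openConn o a₂)
  have hH := Literature.Probability.LatticeModels.prodBernoulli_harris w (isUpperSet_setOf_openEdgeCluster_mem a₁ h𝒜) hU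
    MeasurableSet.of_discrete MeasurableSet.of_discrete
  simp only [← hμ, ← hA₁] at hH
  -- combine
  rw [hmAU] at hH
  have hDnn : 0 ≤ μ.real D := measureReal_nonneg
  have hH' := mul_le_mul_of_nonneg_left hH hDnn
  have key : (μ.real D * μ.real (O₁ ∪ O₂) - μ.real (D ∩ O₂)) * μ.real A₁ + μ.real (D ∩ O₂) * μ.real A₂ ≤
      μ.real D * μ.real E := by
    have hA1split : μ.real (D ∩ O₂) * μ.real A₁ =
        μ.real (D ∩ O₂) * μ.real (A₁ ∩ D) + μ.real (D ∩ O₂) * μ.real (A₁ ∩ Dᶜ) := by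
      rw [hmA1]; ring
    rw [hmE, hmA2]
    nlinarith [hH', h_i, h_ii, hA1split]
  exact key

end UnionExchange

end Summit.CriticalPhenomena.PercolationContinuityZ3.Theorems
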